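import Summits.BirchSwinnertonDyer.BirchSwinnertonDyer.Theses.SmallImageMuTransfer
import Summits.BirchSwinnertonDyer.BirchSwinnertonDyer.Theorems.Rank1ResidualX9MuTransfer
import Summits.BirchSwinnertonDyer.BirchSwinnertonDyer.Theorems.SmallImageMuTransferMuTransferX9CoreClosed
import Literature.NumberTheory.GaloisCohomology.PoitouTateNumberField
import Summits.BirchSwinnertonDyer.BirchSwinnertonDyer.Theorems.SmallImageMuTransferMuTransferX9StubRed
import HarnessLib

/-!
# Route `SmallImageMuTransfer` (rung K6 of BSD, leaf `BSDpOnClassX9`): the leaf from the X9 CHILD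
# `MuTransferX9` (stmt-BirchSwinnertonDyer-19276) instead of the parent `MuTransfer` (19629), and the
# leaf modulo exactly the remaining named facts F1, F2

Cell `bsd-smallim`, seat `bsd-smallim-k6-c2` (gen 5, lead of the line `MuTransfer → MuTransferX9`).
BOOKKEEPING with one structural point.  The closed `Assembly` (19633, koly gen 4) feeds the kernel bridge
`Rank1Residual.bsdpOnClassX9_of_katoMuTransfer` (p407118) with the PARENT crux `MuTransfer`
(`= KatoMuTransfer`: every irreducible `p ≥ 5`, surjective image and CM included), so the leaf's cone
carries, through the split glue `MuTransferSplit` (19278), the published inputs of the NON-X9 cases —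
Kato 2004 Thm. 17.4 for every datum, Rubin 1991 Thm. 12.3, Greenberg–Vatsal 2000 Thm. 1.4 (conjuncts of
`MuTransferInputs`, 19277).  But the bridge consumes the transfer ONLY at X9 pairs (its first step is
`mu_eq_zero_of_katoMuTransfer_of_analyticMuZero … (hX9 : ClassX9 W p)`).  This file records the thinner
dependency in the kernel:

* `smallImageMuTransfer_mu_eq_zero_of_muTransferX9` — per X9 pair, `MuTransferX9 ∧ AnalyticMuZeroX9 ⟹
  μ(D) = 0` for every cyclotomic datum (through any newform, one exists by `hmodP`);
* `smallImageMuTransfer_bsdpOnClassX9_of_muTransferX9` — **`MuTransferX9 → AnalyticMuZeroX9 →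
  SchneiderX9RankOne → PublishedInputsX9 → BSDpOnClassX9`**: the Assembly with the X9 child in place of
  the parent (same proof as the bridge, both analytic ranks: BCS (a) + GV 3.7 pin `ch X = (L_p)`; rank 0
  by the CGLS valuation chain, rank 1 by Wuthrich's engine with the Schneider binder);
* `smallImageMuTransfer_bsdpOnClassX9_of_facts` — **the rung-K6 leaf modulo EXACTLY: F1
  (`Kato2004.exists_divisibilityInputs_fineQuotient_zeta`, Kato Thm. 12.5/12.6 zeta-element package,
  published input), F2 (`Kato2004.mem_pSmul_of_red_eq_zero`, Kato §13.8, in-tree discharge in flight),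
  the two NAMED CONJECTURES of the route (`AnalyticMuZeroX9` = Greenberg's `μ = 0` on X9, class-wide;
  `SchneiderX9RankOne` = Schneider 1985 on the rank-1 X9 pairs) and the eight published inputs
  `PublishedInputsX9`** — by the closed core `Theorems.smallImageMuTransfer_MuTransferX9Core_proof`
  (19842, p476037) and the tree's Poitou–Tate theorem `poitouTate_sum_localTatePairing_eq_zero_holds ℚ`
  (p475389).  Kato 17.4 / Rubin 12.3 / GV 1.4 do NOT occur.

HONEST FRAMING: proves no case of BSD; closes no item (the Assembly item is closed already, `closes` of
the route is the planner's); «types the K6 leaf's surface of record», never summit credit.  Whether the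
route's `closes` chain should run through the child (`Assembly'` with `MuTransferX9`) is the planner's
call — this file only makes the option kernel-checked.
PARTITION (D-0054): X9 (A4; good-ordinary `p ∈ {5,7}`, `ρ̄` irreducible ∧ ¬surjective; book230 0 open
cells, class-wide 790 pairs) — types-the-object-of A4; closes NONE; bears_on: K6
(route-BirchSwinnertonDyer-SmallImageMuTransfer items 19629 → 19276, leaf `Rank1Residual.BSDpOnClassX9`).

References: K. Kato, Astérisque 295 (2004) Thm. 12.5, 12.6, §13.8, §17.13 [Kato2004Asterisque];
A. Burungale, F. Castella, C. Skinner (2025) Thm. 1.1.2 (a) [BurungaleCastellaSkinner2025]; R. Greenberg,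
LNM 1716 (1999) Thm. 4.1, Conj. 1.11 [GreenbergLNM1716]; R. Greenberg, V. Vatsal, Invent. Math. 142 (2000)
Prop. 3.7 [GreenbergVatsal2000]; P. Schneider, Invent. Math. 79 (1985) [Schneider1985]; B. Perrin-Riou,
Invent. Math. 89 (1987) [PerrinRiou1987]; C. Wuthrich, J. London Math. Soc. 89 (2014) [Wuthrich2014];
J. S. Milne, *Arithmetic Duality Theorems* (2006) I Thm. 4.10 (b) [MilneADT2006].
-/

-- the summit and its single problem are both named `BirchSwinnertonDyer` (registry layout D-0017)
set_option linter.dupNamespace false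
set_option autoImplicit false

noncomputable section

open scoped Classical MatrixGroups ModularForm

open CongruenceSubgroup WeierstrassCurve Field
open Literature.NumberTheory.EllipticCurves Literature.NumberTheory.EllipticCurves.ModularForms
open Literature.NumberTheory.EllipticCurves.Rank1Residual (mazurMainConjecture_of_mu_eq_zero
  mazurMainConjecture_neron_of_mu_eq_zero norm_periodRatio_eq_one pPart_of_bsdp)
open Literature.NumberTheory.EllipticCurves.Kato2004 Literature.NumberTheory.GaloisCohomology
open Summit.BirchSwinnertonDyer.BirchSwinnertonDyer.Rank1Residual
open Summit.BirchSwinnertonDyer.BirchSwinnertonDyer.Theses.SmallImageMuTransfer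

namespace Summit.BirchSwinnertonDyer.BirchSwinnertonDyer.Theorems

/-- **Per X9 pair: the X9 child of the transfer and the analytic certificate give `μ(X) = 0` for every
cyclotomic datum** — the `hμ` binder of `X9MuInvariant.lean`, through any newform of `W` (one exists by
modularity, `hmodP`).  Twin of `Rank1Residual.mu_eq_zero_of_katoMuTransfer_of_analyticMuZero` with the
route decl `MuTransferX9` (19276) in place of `KatoMuTransfer`.
[cite: Kato2004Asterisque, §17.13 (p. 280)] [cite: GreenbergLNM1716, §1 Conj. 1.11] -/
theorem smallImageMuTransfer_mu_eq_zero_of_muTransferX9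
    (hmodP : nonempty_modularParametrizationData)
    (hT9 : MuTransferX9) (hA : AnalyticMuZeroX9)
    (W : WeierstrassCurve ℚ) [W.IsElliptic] [W.IsGloballyMinimal] (p : ℕ) [Fact p.Prime]
    (hX9 : ClassX9 W p) :
    ∀ (κ : ZpExtension ℚ p) (γ : Field.absoluteGaloisGroup ℚ),
      κ.IsCyclotomic → κ.IsTopGenerator γ → IsCyclotomicVariable p γ →
      ∀ D : W.SelmerDualData κ γ, D.mu = 0 := by
  intro κ γ hκ hγ hγ' D
  haveI : NeZero (W.conductorNorm ℤ) := ⟨(W.conductorNorm_pos_holds).ne'⟩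
  obtain ⟨Dm⟩ := hmodP W
  exact hT9 W p Dm.f hX9 Dm.isNewformOf (hA W p Dm.f hX9 Dm.isNewformOf) κ γ hκ hγ hγ' D

/-- **The rung-K6 leaf from the X9 CHILD: `MuTransferX9 → AnalyticMuZeroX9 → SchneiderX9RankOne →
PublishedInputsX9 → BSDpOnClassX9`** (route decls by name).  Same proof as the kernel bridge
`bsdpOnClassX9_of_katoMuTransfer` (p407118): `μ = 0` from the two inputs at the X9 pair; the `ϖ`-shaped
certificate via the period unit (A25); BCS (a) + GV Prop. 3.7 pin `ch X(E/ℚ_∞) = (L_p(E))`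
(`mazurMainConjecture_neron_of_mu_eq_zero`); analytic rank `0` by Greenberg Thm. 4.1 and the valuation
chain, analytic rank `1` by Wuthrich 2014 with the Schneider binder; then `pPartBSD`.  The non-X9
published inputs of `MuTransfer` (Kato 17.4 for every datum, Rubin 12.3, GV 1.4) do not occur.
[cite: BurungaleCastellaSkinner2025, Thm. 1.1.2 (a)] [cite: GreenbergLNM1716, Thm. 4.1 (p. 102)]
[cite: GreenbergVatsal2000, Prop. 3.7] [cite: Wuthrich2014, Thm. 1 and §6] -/
theorem smallImageMuTransfer_bsdpOnClassX9_of_muTransferX9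
    (hT9 : MuTransferX9) (hA : AnalyticMuZeroX9) (hC3 : SchneiderX9RankOne)
    (hP : PublishedInputsX9) : BSDpOnClassX9 := by
  obtain ⟨hBCS, hGr, h5, hS, hPR, hmodP, hmodL, hGZK⟩ := hP
  intro W _ _ p _ hran hX9 hfin
  obtain ⟨-, hp, hgood, hord, hirr, -⟩ := id hX9
  -- `μ = 0` for every cyclotomic datum, from the X9 child
  have hμ := smallImageMuTransfer_mu_eq_zero_of_muTransferX9 hmodP hT9 hA W p hX9
  -- the certificate in the `ϖ`-shape of `X9MuInvariant.lean`
  have hcert : ∀ [NeZero (W.conductorNorm ℤ)] (f : CuspForm (Gamma0 (W.conductorNorm ℤ)) 2),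
      IsNewformOf W f → ∀ (ϖ : ℚ), (ϖ : ℝ) * W.realPeriodRat = plusPeriod f →
      ∃ n : ℕ, ‖PowerSeries.coeff n
        (PowerSeries.C (ϖ : ℚ_[p]) * padicLFunction f (unitRoot W p : ℚ_[p]))‖ = 1 := by
    intro _ f hf ϖ hϖeq
    obtain ⟨n, hn⟩ := hA W p f hX9 hf
    refine ⟨n, ?_⟩
    rw [PowerSeries.coeff_C_mul, norm_mul, norm_periodRatio_eq_one h5 W p hp hgood hirr f hf ϖ hϖeq,
      one_mul]
    exact hn
  have hMC := mazurMainConjecture_neron_of_mu_eq_zero hBCS h5 W p hp hgood hord hirr hμ hcert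
  have hbsdp : BSDp W p := by
    rcases Nat.le_one_iff_eq_zero_or_eq_one.mp hran with hr | hr
    · -- analytic rank 0: CGLS's valuation chain
      have hp2 : p ≠ 2 := by omega
      have hL : W.entireLFunction 1 ≠ 0 := (W.analyticRank_eq_zero_iff_holds (hmodL W)).1 hr
      exact bsdp_of_padicValRat_rank_zero W p hr hL hGZK
        (padicValRat_bsd_rank_zero_of_mazurMainConjecture W p hgood hord hL hfin hmodP
          (hGr W p hp2 hgood hord) hMC)
    · -- analytic rank 1: Wuthrich's engine, Schneider certificate supplied by `hC3`
      exact Literature.NumberTheory.EllipticCurves.Rank1Residual.Typed.bsdp_of_missingPPartAt W p hGZK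
        (by omega)
        (Wuthrich2014.missingPPartAt_of_mainConjecture_of_rank_one hS hPR hmodP hGZK W p hp hgood
          hord hr (hC3 W p hX9 hr) hMC)
  exact (pPartBSD_iff_pPart W p).mpr (pPart_of_bsdp hmodL hGZK W p hran hbsdp)

/-- **The rung-K6 leaf `BSDpOnClassX9` modulo EXACTLY its remaining named facts: F1 (Kato 2004
Thm. 12.5/12.6 zeta-element package), F2 (Kato §13.8 kernel of reduction mod `p` on `𝐇¹`), the route's
two NAMED CONJECTURES `AnalyticMuZeroX9` (Greenberg `μ = 0` on X9, class-wide) and `SchneiderX9RankOne`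
(Schneider 1985 on the rank-1 X9 pairs), and the eight published inputs `PublishedInputsX9`.**  The X9
child `MuTransferX9` is supplied by the closed core (item 19842, p476037) with Poitou–Tate over `ℚ` from
the tree (`poitouTate_sum_localTatePairing_eq_zero_holds ℚ`, p475389).  Proves no case of BSD by itself.
[cite: Kato2004Asterisque, Thm. 12.5, Thm. 12.6, §13.8, §17.13 (p. 280)]
[cite: BurungaleCastellaSkinner2025, Thm. 1.1.2 (a)] [cite: MilneADT2006, Ch. I, Thm. 4.10(b)] -/
theorem smallImageMuTransfer_bsdpOnClassX9_of_facts
    (hfineZ : exists_divisibilityInputs_fineQuotient_zeta) (hred : mem_pSmul_of_red_eq_zero)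
    (hA : AnalyticMuZeroX9) (hC3 : SchneiderX9RankOne) (hP : PublishedInputsX9) : BSDpOnClassX9 :=
  smallImageMuTransfer_bsdpOnClassX9_of_muTransferX9
    (smallImageMuTransfer_MuTransferX9Core_proof hfineZ hred
      (poitouTate_sum_localTatePairing_eq_zero_holds ℚ))
    hA hC3 hP

/-- **The rung-K6 leaf `BSDpOnClassX9` modulo EXACTLY F1, the route's two named conjectures
(`AnalyticMuZeroX9`, `SchneiderX9RankOne`) and the eight published inputs `PublishedInputsX9`** — F2 (Kato
§13.8) is now the tree theorem `UniversalNorms.mem_pSmul_of_red_eq_zero_holds` (cell `bsd-smallim` lur-a g2,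
p480014, through k6-g4 g2's reduction), F3 the tree theorem `poitouTate_sum_localTatePairing_eq_zero_holds ℚ`
(cell `bsd-cn100`, p475389).  Pre-written by the line lead k6-c2 g5 (BATON, cell bus l.396 (c)); filed by
b2b-bsdres x10 g40.  Proves no case of BSD by itself; nothing booked.
[cite: Kato2004Asterisque, Thm. 12.5, Thm. 12.6, §17.13 (p. 280)] [cite: BurungaleCastellaSkinner2025, Thm. 1.1.2 (a)] -/
theorem smallImageMuTransfer_bsdpOnClassX9_of_kato
    (hfineZ : exists_divisibilityInputs_fineQuotient_zeta)
    (hA : AnalyticMuZeroX9) (hC3 : SchneiderX9RankOne) (hP : PublishedInputsX9) : BSDpOnClassX9 :=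
  smallImageMuTransfer_bsdpOnClassX9_of_facts hfineZ
    Summit.BirchSwinnertonDyer.BirchSwinnertonDyer.Rank1Residual.UniversalNorms.mem_pSmul_of_red_eq_zero_holds hA hC3 hP

end Summit.BirchSwinnertonDyer.BirchSwinnertonDyer.Theorems

end
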